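import Summits.KontsevichZagierPeriods.KontsevichZagierPeriods.Theorems.TerasomaMultiplicationMultiplicationAccessibleCornerGraphSpelling
import Summits.KontsevichZagierPeriods.KontsevichZagierPeriods.Theorems.TerasomaMultiplicationMultiplicationAccessibleBlowupChart

/-!
# `MultiplicationAccessible` (stmt-KontsevichZagierPeriods-12305), line `shifted-family-prime-sieve`:
the corner Stokes graph package, III — the two representations and the bound

For the Liouville rotation flow at `p = 3`: with
`G t = (1 + t₀/ζ + t₀t₁/ζ²)/3 · ∏_{k<3} t_k^(x+k/3−1)(1 − t_k)^(s−1)` (`ζ = (t₀t₁t₂)^(1/3)`, `x ≥ 2`,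
`s ≥ 3`) the cube representation `[(0,1)³, G]` and the chart representation `[U, G(t(u))·y²]`
(`U` the corner blow-up chart domain, `t_k = 1 − yθ_k`) exist — semialgebraic integrands (rational
powers of positive polynomials), bounded on bounded domains — and the graph density obeys
`|G(t(u))y²| ≤ 3^(3s−1)(1 − ζ)^(3s−1)` on `U` (division spelling `G(t)y² = (1/3)y^(3s−1)K·ΣM/t`
with `K, M_k/t_k ≤ 1`, and AM–GM `ζ ≤ 1 − y/3`): `cornerGraphReps`, registered sub-goal, the inputs
of the landed `v`-move `cornerStokesV` and chart move `blowupChartThree`.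
References: Kontsevich–Zagier 2001 §1.1–1.2; Bochnak–Coste–Roy 1998 Prop. 2.2.6.
-/

noncomputable section

open MeasureTheory Set Real
open scoped BigOperators
open Literature.NumberTheory.Transcendental
open Literature.NumberTheory.Transcendental.KZ
open Literature.ModelTheory.ExponentialFields (IsSemialgebraic)

namespace Summit.KontsevichZagierPeriods.TerasomaMultiplication.MultiplicationAccessible

namespace CornerGraph

/-- On the open cube `|G t| ≤ 1` (`x, s ≥ 1`): `G = (1/3)(A₀ + A₁ + A₂)·∏(1 − t_k)^(s−1)` with every
`A_i`, a product of powers `t_k^e`, `e ≥ 0`, in `[0,1]`. [cite: KontsevichZagier2001, §1.2] -/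
theorem abs_graph_le_one {x s : ℚ} (hx : 1 ≤ x) (hs : 1 ≤ s) {G : (Fin 3 → ℝ) → ℝ}
    (hG : ∀ t : Fin 3 → ℝ, G t = (1 + t 0 / (t 0 * t 1 * t 2) ^ ((1:ℝ)/3) +
      t 0 * t 1 / ((t 0 * t 1 * t 2) ^ ((1:ℝ)/3)) ^ 2) / 3 *
      ∏ k : Fin 3, (t k) ^ ((x:ℝ) + ((k:ℕ):ℝ) / 3 - 1) * (1 - t k) ^ ((s:ℝ) - 1))
    {t : Fin 3 → ℝ} (ht : ∀ i, t i ∈ Set.Ioo (0:ℝ) 1) : |G t| ≤ 1 := by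
  have hxR : (1:ℝ) ≤ x := by exact_mod_cast hx
  have hsR : (1:ℝ) ≤ s := by exact_mod_cast hs
  obtain ⟨h0, h0'⟩ := ht 0
  obtain ⟨h1, h1'⟩ := ht 1
  obtain ⟨h2, h2'⟩ := ht 2
  rw [graph_apply x s hG h0 h1 h2]
  obtain ⟨a0, a0'⟩ := triple_rpow_mem (e0 := (x:ℝ) - 1) (e1 := (x:ℝ) - 2/3) (e2 := (x:ℝ) - 1/3)
    h0.le h0'.le h1.le h1'.le h2.le h2'.le (by linarith) (by linarith) (by linarith)
  obtain ⟨a1, a1'⟩ := triple_rpow_mem (e0 := (x:ℝ) - 1/3) (e1 := (x:ℝ) - 1) (e2 := (x:ℝ) - 2/3)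
    h0.le h0'.le h1.le h1'.le h2.le h2'.le (by linarith) (by linarith) (by linarith)
  obtain ⟨a2, a2'⟩ := triple_rpow_mem (e0 := (x:ℝ) - 2/3) (e1 := (x:ℝ) - 1/3) (e2 := (x:ℝ) - 1)
    h0.le h0'.le h1.le h1'.le h2.le h2'.le (by linarith) (by linarith) (by linarith)
  obtain ⟨b0, b0'⟩ := triple_rpow_mem (t0 := 1 - t 0) (t1 := 1 - t 1) (t2 := 1 - t 2)
    (e0 := (s:ℝ) - 1) (e1 := (s:ℝ) - 1) (e2 := (s:ℝ) - 1) (by linarith) (by linarith) (by linarith)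
    (by linarith) (by linarith) (by linarith) (by linarith) (by linarith) (by linarith)
  rw [abs_of_nonneg (mul_nonneg (mul_nonneg (by norm_num) (by linarith)) b0)]
  have hsum := mul_le_mul (show t 0 ^ ((x:ℝ) - 1) * t 1 ^ ((x:ℝ) - 2/3) * t 2 ^ ((x:ℝ) - 1/3) +
      t 0 ^ ((x:ℝ) - 1/3) * t 1 ^ ((x:ℝ) - 1) * t 2 ^ ((x:ℝ) - 2/3) +
      t 0 ^ ((x:ℝ) - 2/3) * t 1 ^ ((x:ℝ) - 1/3) * t 2 ^ ((x:ℝ) - 1) ≤ 3 by linarith) b0' b0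
    (by norm_num)
  linarith

/-- `G` is `ℚ`-semialgebraic on the open cube: there it is a polynomial in rational powers of the
positive coordinates `t_k` and `1 − t_k` (division-free form `graph_apply`).
[cite: BochnakCosteRoy1998, Prop. 2.2.6] -/
theorem isSemialgebraicFunOn_graph (x s : ℚ) {G : (Fin 3 → ℝ) → ℝ}
    (hG : ∀ t : Fin 3 → ℝ, G t = (1 + t 0 / (t 0 * t 1 * t 2) ^ ((1:ℝ)/3) +
      t 0 * t 1 / ((t 0 * t 1 * t 2) ^ ((1:ℝ)/3)) ^ 2) / 3 *
      ∏ k : Fin 3, (t k) ^ ((x:ℝ) + ((k:ℕ):ℝ) / 3 - 1) * (1 - t k) ^ ((s:ℝ) - 1)) :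
    IsSemialgebraicFunOn ℚ {t : Fin 3 → ℝ | ∀ i, t i ∈ Set.Ioo (0:ℝ) 1} G := by
  have hB : IsSemialgebraic ℚ {t : Fin 3 → ℝ | ∀ i, t i ∈ Set.Ioo (0:ℝ) 1} :=
    KZ.isSemialgebraic_box 3
  have hc : ∀ i : Fin 3, IsSemialgebraicFunOn ℚ {t : Fin 3 → ℝ | ∀ i, t i ∈ Set.Ioo (0:ℝ) 1}
      (fun t => t i) := fun i => isSemialgebraicFunOn_apply hB i
  have h1 : IsSemialgebraicFunOn ℚ {t : Fin 3 → ℝ | ∀ i, t i ∈ Set.Ioo (0:ℝ) 1}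
      (fun _ => (1:ℝ)) := by simpa using isSemialgebraicFunOn_ratCast hB 1
  have hp : ∀ (i : Fin 3) (q : ℚ), IsSemialgebraicFunOn ℚ {t : Fin 3 → ℝ | ∀ i, t i ∈ Set.Ioo (0:ℝ) 1}
      (fun t => t i ^ ((q:ℚ):ℝ)) := fun i q =>
    (hc i).rpow_ratCast hB (fun t ht => (ht i).1) q
  have hq : ∀ (i : Fin 3) (q : ℚ), IsSemialgebraicFunOn ℚ {t : Fin 3 → ℝ | ∀ i, t i ∈ Set.Ioo (0:ℝ) 1}
      (fun t => (1 - t i) ^ ((q:ℚ):ℝ)) := fun i q =>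
    (h1.fun_sub (hc i)).rpow_ratCast hB (fun t ht => by linarith [(ht i).2]) q
  have h3 : IsSemialgebraicFunOn ℚ {t : Fin 3 → ℝ | ∀ i, t i ∈ Set.Ioo (0:ℝ) 1}
      (fun _ => (((1/3 : ℚ)) : ℝ)) := isSemialgebraicFunOn_ratCast hB (1/3)
  have hF := (h3.fun_mul ((((hp 0 (x - 1)).fun_mul (hp 1 (x - 2/3))).fun_mul (hp 2 (x - 1/3))).fun_add
    (((hp 0 (x - 1/3)).fun_mul (hp 1 (x - 1))).fun_mul (hp 2 (x - 2/3))) |>.fun_add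
    (((hp 0 (x - 2/3)).fun_mul (hp 1 (x - 1/3))).fun_mul (hp 2 (x - 1))))).fun_mul
    (((hq 0 (s - 1)).fun_mul (hq 1 (s - 1))).fun_mul (hq 2 (s - 1)))
  refine hF.congr fun t ht => ?_
  rw [graph_apply x s hG (ht 0).1 (ht 1).1 (ht 2).1]
  push_cast
  ring_nf

/-- **The bound on the chart domain**: `|G(t(u))·y²| ≤ 3^(3s−1)(1 − ζ)^(3s−1)` on `U` (`x ≥ 1`,
`s ≥ 1`): `G(t)y² = (1/3)y^(3s−1)K(A₀ + A₁ + A₂)` with `K, A_i ∈ [0,1]`, and `y ≤ 3(1 − ζ)` by AM–GM.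
[cite: KontsevichZagier2001, §1.2] -/
theorem abs_graphChart_le {x s : ℚ} (hx : 1 ≤ x) (hs : 1 ≤ s) {G : (Fin 3 → ℝ) → ℝ}
    (hG : ∀ t : Fin 3 → ℝ, G t = (1 + t 0 / (t 0 * t 1 * t 2) ^ ((1:ℝ)/3) +
      t 0 * t 1 / ((t 0 * t 1 * t 2) ^ ((1:ℝ)/3)) ^ 2) / 3 *
      ∏ k : Fin 3, (t k) ^ ((x:ℝ) + ((k:ℕ):ℝ) / 3 - 1) * (1 - t k) ^ ((s:ℝ) - 1))
    {u : Fin 3 → ℝ} (hu : 0 < u 0 ∧ 0 < u 1 ∧ u 0 + u 1 < 1 ∧ 0 < u 2 ∧ u 2 * (1 - u 0 - u 1) < 1 ∧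
      u 2 * u 0 < 1 ∧ u 2 * u 1 < 1) :
    |G ![1 - u 2 * (1 - u 0 - u 1), 1 - u 2 * u 0, 1 - u 2 * u 1] * (u 2) ^ 2| ≤
      (3:ℝ) ^ (3 * (s:ℝ) - 1) *
        (1 - ((1 - u 2 * (1 - u 0 - u 1)) * (1 - u 2 * u 0) * (1 - u 2 * u 1)) ^ ((1:ℝ)/3)) ^
          (3 * (s:ℝ) - 1) := by
  have hxR : (1:ℝ) ≤ x := by exact_mod_cast hx
  have hsR : (1:ℝ) ≤ s := by exact_mod_cast hs
  obtain ⟨ha, hb, hab, hy, h0, h1, h2⟩ := hu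
  obtain ⟨⟨ht0, ht0'⟩, ⟨ht1, ht1'⟩, ⟨ht2, ht2'⟩⟩ := t_mem ha hb hab hy h0 h1 h2
  have hζ := zeta_le ha hb hab hy h0 h1 h2
  rw [graph_chart x s hG ha hb hab hy h0 h1 h2]
  set y := u 2
  set ζ := ((1 - y * (1 - u 0 - u 1)) * (1 - y * u 0) * (1 - y * u 1)) ^ ((1:ℝ)/3)
  obtain ⟨a0, a0'⟩ := triple_rpow_mem (e0 := (x:ℝ) - 1) (e1 := (x:ℝ) - 2/3) (e2 := (x:ℝ) - 1/3)
    ht0.le ht0'.le ht1.le ht1'.le ht2.le ht2'.le (by linarith) (by linarith) (by linarith)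
  obtain ⟨a1, a1'⟩ := triple_rpow_mem (e0 := (x:ℝ) - 1/3) (e1 := (x:ℝ) - 1) (e2 := (x:ℝ) - 2/3)
    ht0.le ht0'.le ht1.le ht1'.le ht2.le ht2'.le (by linarith) (by linarith) (by linarith)
  obtain ⟨a2, a2'⟩ := triple_rpow_mem (e0 := (x:ℝ) - 2/3) (e1 := (x:ℝ) - 1/3) (e2 := (x:ℝ) - 1)
    ht0.le ht0'.le ht1.le ht1'.le ht2.le ht2'.le (by linarith) (by linarith) (by linarith)
  -- `K ≤ 1`
  have hθ : 0 ≤ (1 - u 0 - u 1) * u 0 * u 1 := by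
    have : 0 < 1 - u 0 - u 1 := by linarith
    positivity
  have hθ' : (1 - u 0 - u 1) * u 0 * u 1 ≤ 1 :=
    mul_le_one₀ (mul_le_one₀ (by linarith) ha.le (by linarith)) hb.le (by linarith)
  have hK0 : 0 ≤ ((1 - u 0 - u 1) * u 0 * u 1) ^ ((s:ℝ) - 1) := rpow_nonneg hθ _
  have hK1 : ((1 - u 0 - u 1) * u 0 * u 1) ^ ((s:ℝ) - 1) ≤ 1 := rpow_le_one hθ hθ' (by linarith)
  -- `y ≤ 3 (1 - ζ)`, so `y^(3s-1) ≤ 3^(3s-1) (1 - ζ)^(3s-1)`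
  have hy3 : y ≤ 3 * (1 - ζ) := by linarith
  have hypow : y ^ (3 * (s:ℝ) - 1) ≤ (3:ℝ) ^ (3 * (s:ℝ) - 1) * (1 - ζ) ^ (3 * (s:ℝ) - 1) := by
    rw [← mul_rpow (by norm_num) (by linarith)]
    exact rpow_le_rpow hy.le hy3 (by linarith)
  have hy0 : 0 ≤ y ^ (3 * (s:ℝ) - 1) := rpow_nonneg hy.le _
  set A := (1 - y * (1 - u 0 - u 1)) ^ ((x:ℝ) - 1) * (1 - y * u 0) ^ ((x:ℝ) - 2/3) *
      (1 - y * u 1) ^ ((x:ℝ) - 1/3) +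
    (1 - y * (1 - u 0 - u 1)) ^ ((x:ℝ) - 1/3) * (1 - y * u 0) ^ ((x:ℝ) - 1) *
      (1 - y * u 1) ^ ((x:ℝ) - 2/3) +
    (1 - y * (1 - u 0 - u 1)) ^ ((x:ℝ) - 2/3) * (1 - y * u 0) ^ ((x:ℝ) - 1/3) *
      (1 - y * u 1) ^ ((x:ℝ) - 1)
  set Kθ := ((1 - u 0 - u 1) * u 0 * u 1) ^ ((s:ℝ) - 1)
  have hA0 : 0 ≤ A := by positivity
  have hA3 : A ≤ 3 := by linarith
  rw [abs_of_nonneg (by positivity)]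
  have hT0 : 0 ≤ (3:ℝ) ^ (3 * (s:ℝ) - 1) * (1 - ζ) ^ (3 * (s:ℝ) - 1) := hy0.trans hypow
  have key := mul_le_mul (mul_le_mul hypow hK1 hK0 hT0) hA3 hA0 (mul_nonneg hT0 zero_le_one)
  linarith

end CornerGraph

/-- **The two representations and the bound** (registered sub-goal `cornerGraphReps` of
`stub_gmThreeShifted`): for `x ≥ 2`, `s ≥ 3` the cube representation `[(0,1)³, G]` and the chart
representation `[U, G(t(u))·y²]` exist (semialgebraic integrands — rational powers of positive
polynomials, composed with the polynomial chart — bounded on domains of finite volume), and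
`|G(t(u))y²| ≤ 3^(3s−1)(1 − ζ(u))^(3s−1)` on `U`. [cite: KontsevichZagier2001, §1.1–1.2] -/
theorem cornerGraphReps : ∀ (x s : ℚ), 2 ≤ x → 3 ≤ s → ∀ (G : (Fin 3 → ℝ) → ℝ), (∀ t : Fin 3 → ℝ, G t = (1 + t 0 / (t 0 * t 1 * t 2) ^ ((1:ℝ)/3) +
      t 0 * t 1 / ((t 0 * t 1 * t 2) ^ ((1:ℝ)/3)) ^ 2) / 3 *
      ∏ k : Fin 3, (t k) ^ ((x:ℝ) + ((k:ℕ):ℝ) / 3 - 1) * (1 - t k) ^ ((s:ℝ) - 1)) →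
    (∃ r₀ : KZ.IntegralRep 3, r₀.domain = {t : Fin 3 → ℝ | ∀ i, t i ∈ Set.Ioo (0:ℝ) 1} ∧ r₀.integrand = G) ∧
    (∃ rU : KZ.IntegralRep 3, rU.domain = {u : Fin 3 → ℝ | 0 < u 0 ∧ 0 < u 1 ∧ u 0 + u 1 < 1 ∧ 0 < u 2 ∧ u 2 * (1 - u 0 - u 1) < 1 ∧ u 2 * u 0 < 1 ∧ u 2 * u 1 < 1} ∧
      rU.integrand = fun u => G ![1 - u 2 * (1 - u 0 - u 1), 1 - u 2 * u 0, 1 - u 2 * u 1] * (u 2) ^ 2) ∧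
    (∃ C : ℝ, ∀ u : Fin 3 → ℝ, (0 < u 0 ∧ 0 < u 1 ∧ u 0 + u 1 < 1 ∧ 0 < u 2 ∧ u 2 * (1 - u 0 - u 1) < 1 ∧
      u 2 * u 0 < 1 ∧ u 2 * u 1 < 1) →
      |G ![1 - u 2 * (1 - u 0 - u 1), 1 - u 2 * u 0, 1 - u 2 * u 1] * (u 2) ^ 2| ≤
        C * (1 - ((1 - u 2 * (1 - u 0 - u 1)) * (1 - u 2 * u 0) * (1 - u 2 * u 1)) ^ ((1:ℝ)/3)) ^ (3 * (s:ℝ) - 1)) := by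
  intro x s hx hs G hG
  have hx1 : (1:ℚ) ≤ x := by linarith
  have hs1 : (1:ℚ) ≤ s := by linarith
  have hs1R : (1:ℝ) ≤ s := by exact_mod_cast hs1
  -- the cube
  set B : Set (Fin 3 → ℝ) := {t : Fin 3 → ℝ | ∀ i, t i ∈ Set.Ioo (0:ℝ) 1} with hBdef
  have hBsa : IsSemialgebraic ℚ B := KZ.isSemialgebraic_box 3
  have hBmeas : MeasurableSet B :=
    Literature.ModelTheory.ExponentialFields.IsSemialgebraic.measurableSet_holds hBsa
  have hBvol : volume B < ⊤ :=
    lt_of_le_of_lt (measure_mono fun t (ht : t ∈ B) =>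
      (⟨fun i => (ht i).1.le, fun i => (ht i).2.le⟩ : t ∈ Icc (0 : Fin 3 → ℝ) 1))
      (measure_Icc_lt_top (a := (0 : Fin 3 → ℝ)) (b := 1))
  have hGsa : IsSemialgebraicFunOn ℚ B G := CornerGraph.isSemialgebraicFunOn_graph x s hG
  have hGint : IntegrableOn G B :=
    ⟨aestronglyMeasurable_of_isSemialgebraicFunOn hGsa hBmeas,
      HasFiniteIntegral.restrict_of_bounded (C := 1) hBvol ((ae_restrict_mem hBmeas).mono
        fun t ht => by rw [Real.norm_eq_abs]; exact CornerGraph.abs_graph_le_one hx1 hs1 hG ht)⟩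
  -- the chart domain
  set U : Set (Fin 3 → ℝ) := {u : Fin 3 → ℝ | 0 < u 0 ∧ 0 < u 1 ∧ u 0 + u 1 < 1 ∧ 0 < u 2 ∧
    u 2 * (1 - u 0 - u 1) < 1 ∧ u 2 * u 0 < 1 ∧ u 2 * u 1 < 1} with hUdef
  have hUsa : IsSemialgebraic ℚ U := CornerV.isSemialgebraic_U
  have hUmeas : MeasurableSet U :=
    Literature.ModelTheory.ExponentialFields.IsSemialgebraic.measurableSet_holds hUsa
  have hUvol : volume U < ⊤ :=
    lt_of_le_of_lt (measure_mono fun u (hu : u ∈ U) => CornerV.U_subset_box hu)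
      (measure_Icc_lt_top (a := (0 : Fin 3 → ℝ)) (b := fun i => if i = 2 then 3 else 1))
  have hΦ : IsSemialgebraicMapOn ℚ U
      (fun u : Fin 3 → ℝ => ![1 - u 2 * (1 - u 0 - u 1), 1 - u 2 * u 0, 1 - u 2 * u 1]) :=
    BlowupChart.isSemialgebraicMapOn_blowupPhi (fun _ => rfl) hUsa
  have hmaps : MapsTo (fun u : Fin 3 → ℝ => ![1 - u 2 * (1 - u 0 - u 1), 1 - u 2 * u 0, 1 - u 2 * u 1])
      U B := BlowupChart.blowupPhi_mapsTo (fun _ => rfl)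
  have hGDsa : IsSemialgebraicFunOn ℚ U
      (fun u => G ![1 - u 2 * (1 - u 0 - u 1), 1 - u 2 * u 0, 1 - u 2 * u 1] * (u 2) ^ 2) :=
    ((IsSemialgebraicFunOn.comp_isSemialgebraicMapOn_holds hGsa hΦ hmaps).congr
      fun u _ => rfl).fun_mul ((isSemialgebraicFunOn_apply hUsa 2).fun_pow 2)
  have hbound : ∀ u ∈ U, |G ![1 - u 2 * (1 - u 0 - u 1), 1 - u 2 * u 0, 1 - u 2 * u 1] * (u 2) ^ 2| ≤
      (3:ℝ) ^ (3 * (s:ℝ) - 1) := by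
    intro u hu
    refine (CornerGraph.abs_graphChart_le hx1 hs1 hG hu).trans ?_
    obtain ⟨hz0, hz1⟩ := CornerV.zeta_mem (Z := fun u : Fin 3 → ℝ =>
      ((1 - u 2 * (1 - u 0 - u 1)) * (1 - u 2 * u 0) * (1 - u 2 * u 1)) ^ ((1:ℝ)/3)) (fun _ => rfl) hu
    have h1 : (1 - ((1 - u 2 * (1 - u 0 - u 1)) * (1 - u 2 * u 0) * (1 - u 2 * u 1)) ^ ((1:ℝ)/3)) ^
        (3 * (s:ℝ) - 1) ≤ 1 := rpow_le_one (by linarith) (by linarith) (by linarith)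
    have h3 : 0 ≤ (3:ℝ) ^ (3 * (s:ℝ) - 1) := by positivity
    nlinarith
  have hGDint : IntegrableOn
      (fun u => G ![1 - u 2 * (1 - u 0 - u 1), 1 - u 2 * u 0, 1 - u 2 * u 1] * (u 2) ^ 2) U :=
    ⟨aestronglyMeasurable_of_isSemialgebraicFunOn hGDsa hUmeas,
      HasFiniteIntegral.restrict_of_bounded (C := (3:ℝ) ^ (3 * (s:ℝ) - 1)) hUvol
        ((ae_restrict_mem hUmeas).mono fun u hu => by rw [Real.norm_eq_abs]; exact hbound u hu)⟩
  refine ⟨⟨⟨B, G, hBsa, hGsa, hGint⟩, rfl, rfl⟩, ⟨⟨U, _, hUsa, hGDsa, hGDint⟩, rfl, rfl⟩,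
    ⟨(3:ℝ) ^ (3 * (s:ℝ) - 1), fun u hu => CornerGraph.abs_graphChart_le hx1 hs1 hG hu⟩⟩

end Summit.KontsevichZagierPeriods.TerasomaMultiplication.MultiplicationAccessible

end
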